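import Summits.CriticalPhenomena.PercolationContinuityZ3.Theorems.Transplant.SqShadowRouteData
import Summits.CriticalPhenomena.PercolationContinuityZ3.Theorems.Transplant.HexShadowVRouteData
import HarnessLib

/-!
# SQUARE SHADOWS — port of «HexShadowVRouteData» to the square-shadow interface: the square clipped blocks of radius `R` (`sqBlkR`), the window half-planes `SqShadow.InWin`, the certified terminals `SqShadow.Terminals`, and the instance node `SqShadow.ShapedLinkage R` (the routing data `VRouteData` is the hex file's, reused)

builds on p205010 (kernel theorem, internal audit signed; external expert review pending) — NOT used in this file.  Lane `prim-bschramm`, seat `prim-bschramm-p2` (gen 42; class C1b;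
memo §148); helper file (`--supports stmt-CriticalPhenomena-4575 --as helper`).  Statements and proofs from the hexagonal twin with `Ψ : SqShadow G` for `Φ : HexShadow G`, sup-norm squares
`sqBall` for lattice hexagons, and the square clipped blocks `sqBlk z t s = sqBall z 3 ∩ {w₀ ≤ z₀ + t} ∩ {w₁ ≤ z₁ + s}` (clipping at the common right side of `B_{3n}`, `B'_n` and at
the top of the window) for the hexagonal ones.
[cite: DuminilCopinSidoraviciusTassion2016, §2.3 (proof of Fact 2, pp. 6–7)] [cite: NewmanTassionWu2017, §3.2]
-/

noncomputable section

namespace Summit.CriticalPhenomena.PercolationContinuityZ3.Theorems.Transplant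

open MeasureTheory Literature.Probability.Percolation Literature.Probability.LatticeModels SimpleGraph Filter
open scoped Classical Topology

/-! ## §2 The terminals the generic side certifies, and the instance node -/

/-- **The clipped block of radius `R`**: `sqBall z R ∩ {w₀ ≤ z₀ + t} ∩ {w₀ + w₁ ≤ z₀ + z₁ + s}` (`t, s ≥ R`: no clipping in that direction); for `R = 3`
this is «HexShadowRouteData»'s `sqBlk z t s` (`sqBlkR_three`).  The radius is a parameter of the node so that an instance may ask for larger surgery blocks.
[cite: DuminilCopinSidoraviciusTassion2016, §2.3, proof of Fact 2 (the ball B_R(z))] -/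
def sqBlkR (R : ℕ) (z : Site 2) (t s : ℕ) : Set (Site 2) := {w | w ∈ sqBall z R ∧ w 0 ≤ z 0 + t ∧ w 1 ≤ z 1 + s}

/-- Membership in a clipped block of radius `R`. [folklore] -/
@[simp] theorem mem_sqBlkR {R : ℕ} {z : Site 2} {t s : ℕ} {w : Site 2} :
    w ∈ sqBlkR R z t s ↔ w ∈ sqBall z R ∧ w 0 ≤ z 0 + t ∧ w 1 ≤ z 1 + s := Iff.rfl

/-- For `R = 3` the block is `sqBlk`. [folklore] -/
theorem sqBlkR_three (z : Site 2) (t s : ℕ) : sqBlkR 3 z t s = sqBlk z t s := rfl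

/-- The two half-planes of the window near the block of `z` (in block parameters): `w₀ ≤ z₀ + t` and `w₁ ≤ z₁ + s` — where the vertices of `γ_min`
(which lies over `B_{3n} ⊆ {ξ ≤ 3m} ∩ {η ≤ 3m}`) can be, `t = t_D = 3m − ξ(z)`, `s = s_R = 3m − η(z)`. [folklore] -/
def SqShadow.InWin (z : Site 2) (t s : ℕ) (q : Site 2) : Prop := q 0 ≤ z 0 + t ∧ q 1 ≤ z 1 + s

/-- **The terminal data the generic routing hands to the instance** (everything «HexShadowVRouting» can certify about the first/last visits `E₁, E₂` of
`γ_min(ω)` to the cleared vertex set `W` and the exit `w'` of the `(P2)`-witness): `E₁ ≠ E₂` in `W` over the rerouting block `sqBlk z t_R s_R`, not over `z`; `w' ∈ W` over a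
column different from `z` and from the columns of `E₁, E₂`; and neighbours `o₁ → E₁ → a₁`, `a₂ → E₂ → o₂` along `γ_min` — `o₁, o₂ ∉ W` (the vertices just
before the first / just after the last visit), all four over the window half-planes, pairwise distinct as vertices of a self-avoiding path (`a₁ = a₂` only
when it is the vertex over `z`), `a₁ ≠ E₂`, `a₂ ≠ E₁`, and all four columns different from that of `w'` (which is off the columns of `γ_min`).
[cite: DuminilCopinSidoraviciusTassion2016, §2.3 (proof of Fact 2: u', v', w')] -/
structure SqShadow.Terminals {V : Type} {G : SimpleGraph V} (Ψ : SqShadow G) (R : ℕ) (z : Site 2) (tR tD sR : ℕ) (W : Set V) (E₁ E₂ w' : V) : Prop where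
  ne : E₁ ≠ E₂
  E₁W : E₁ ∈ W
  E₂W : E₂ ∈ W
  E₁R : Ψ.sh E₁ ∈ sqBlkR R z tR sR
  E₂R : Ψ.sh E₂ ∈ sqBlkR R z tR sR
  E₁z : Ψ.sh E₁ ≠ z
  E₂z : Ψ.sh E₂ ≠ z
  w'W : w' ∈ W
  w'z : Ψ.sh w' ≠ z
  w'E₁ : Ψ.sh w' ≠ Ψ.sh E₁
  w'E₂ : Ψ.sh w' ≠ Ψ.sh E₂
  nbrs : ∃ o₁ a₁ a₂ o₂ : V, G.Adj o₁ E₁ ∧ G.Adj E₁ a₁ ∧ G.Adj a₂ E₂ ∧ G.Adj E₂ o₂ ∧ o₁ ∉ W ∧ o₂ ∉ W ∧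
    SqShadow.InWin z tD sR (Ψ.sh o₁) ∧ SqShadow.InWin z tD sR (Ψ.sh a₁) ∧ SqShadow.InWin z tD sR (Ψ.sh a₂) ∧ SqShadow.InWin z tD sR (Ψ.sh o₂) ∧
    a₁ ≠ o₁ ∧ a₁ ≠ E₂ ∧ a₂ ≠ o₂ ∧ a₂ ≠ E₁ ∧ o₁ ≠ o₂ ∧ o₁ ≠ a₂ ∧ a₁ ≠ o₂ ∧ (a₁ = a₂ → Ψ.sh a₁ = z) ∧
    Ψ.sh w' ≠ Ψ.sh o₁ ∧ Ψ.sh w' ≠ Ψ.sh a₁ ∧ Ψ.sh w' ≠ Ψ.sh a₂ ∧ Ψ.sh w' ≠ Ψ.sh o₂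

/-- **NODE (instance obligation) — SHAPED LOCAL LINKAGE with surgery radius `R`.**  For every block pair `sqBlkR R z t_R s_R ⊆ sqBlkR R z t_D s_D` clipped in
at most one direction the instance chooses a cleared VERTEX set `W` — containing every vertex over `sqBall z 1 ∩ sqBlkR R z t_D s_D` and contained in the
lift of `sqBlkR R z t_D s_D` (so it may drop the block's degenerate vertices) — such that every terminal triple certified by `Terminals` admits a SWAP PAIR of
routings (rerouted piece inside `W ∩ \overline{sqBlkR R z t_R s_R}`, branch inside `W`; the successor of the attachment vertex and the first branch vertex
exchanged).  DST's "three disjoint paths in `\overline{B_R(z)} ∖ {z}`" in the form the vertex-set surgery consumes; an internal obligation on the instance,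
never asserted (aimed at the `(111)`-films `F_k`, `k ≥ 4`, where `LocalLinkage` fails; the generic routing «HexShadowVRouting» consumes `R = 3`). [cite: DuminilCopinSidoraviciusTassion2016, §2.3 (proof of Fact 2, p. 6: the choice of R)] [cite: NewmanTassionWu2017, §3.2 (Def. 3.7)] -/
def SqShadow.ShapedLinkage {V : Type} {G : SimpleGraph V} (Ψ : SqShadow G) (R : ℕ) : Prop :=
  ∀ (z : Site 2) (tR tD sR sD : ℕ), tR ≤ tD → sR ≤ sD → (R ≤ tR ∨ R ≤ sR) →
    ∃ W : Set V, (∀ x ∈ W, Ψ.sh x ∈ sqBlkR R z tD sD) ∧ (∀ x, Ψ.sh x ∈ sqBall z 1 → Ψ.sh x ∈ sqBlkR R z tD sD → x ∈ W) ∧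
      ∀ (E₁ E₂ w' : V), Ψ.Terminals R z tR tD sR W E₁ E₂ w' →
        ∃ r₁ r₂ : VRouteData G (W ∩ Ψ.lift (sqBlkR R z tR sR)) W E₁ E₂ w', r₁.y = r₂.b ∧ r₁.b = r₂.y

/-! ## §3 The keyed routing from a swap pair -/

namespace SqShadow

variable {V : Type} {G : SimpleGraph V} (Ψ : SqShadow G)

/-- **The cleared set and the keyed routing under `ShapedLinkage`.** [cite: DuminilCopinSidoraviciusTassion2016, §2.3, proof of Fact 2] -/
theorem exists_W_of_shapedLinkage [Countable V] {R : ℕ} (hL : Ψ.ShapedLinkage R) (z : Site 2) {tR tD sR sD : ℕ} (htRD : tR ≤ tD) (hsRD : sR ≤ sD)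
    (hone : R ≤ tR ∨ R ≤ sR) :
    ∃ W : Set V, (∀ x ∈ W, Ψ.sh x ∈ sqBlkR R z tD sD) ∧ (∀ x, Ψ.sh x ∈ sqBall z 1 → Ψ.sh x ∈ sqBlkR R z tD sD → x ∈ W) ∧
      ∀ (E₁ E₂ w' : V), Ψ.Terminals R z tR tD sR W E₁ E₂ w' →
        ∃ r : VRouteData G (W ∩ Ψ.lift (sqBlkR R z tR sR)) W E₁ E₂ w', vtxKey V r.y < vtxKey V r.b := by
  obtain ⟨W, hW1, hW2, hW3⟩ := hL z tR tD sR sD htRD hsRD hone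
  refine ⟨W, hW1, hW2, fun E₁ E₂ w' hT => ?_⟩
  obtain ⟨r₁, r₂, hy, hb⟩ := hW3 E₁ E₂ w' hT
  exact VRouteData.exists_key r₁ r₂ hy hb

end SqShadow

end Summit.CriticalPhenomena.PercolationContinuityZ3.Theorems.Transplant

end
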